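import Literature.Computability.Complexity.ExpPadding
import Literature.Computability.Complexity.MapFstMachine
import Literature.Computability.MetaComplexity.UHSPadParams
import Literature.Computability.MetaComplexity.UHSSearch
import HarnessLib

/-!
# Discharge of Hirahara's Lemma 2.3 / Cor. 6.4: a universal heuristic scheme gives `DTIME(2^{O(n / log n)})`

Topic `Literature/Computability/MetaComplexity`, final layer of the discharge of the named fact
`Hirahara2021_mem_DTIME_of_hasUHS` (`UniversalHeuristicSchemes.lean`; Hirahara, ECCC TR21-058,
Lemma 2.3 = Cor. 6.4, proved there via Thm. 6.3): **for every efficient universal machine `U` and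
every language `L`, a universal heuristic scheme for `L` puts `L` in
`⋃ c, DTIME (fun n => 2 ^ (c * n / Nat.log 2 n))`.**

The machine is the sequential composite (per-input additive time,
`Turing.TM2ComputableAux.comp_outputsWithin`) of

1. the parameter stage `UHSPad.FFn` (`UHSPadParams.lean`): `x ↦ ⟨u(n), x⟩`, polynomial time;
2. the exponential pad `expPad 1` (`ExpPadding.lean`, time `C · 2^{|u|} + C`) applied to the first
   component by the wrapper `mapFstAux` (`MapFstMachine.lean`): `⟨u, x⟩ ↦ ⟨1^{2^{|u|}} 0 u, x⟩`;
3. the search stage `UHSSearch.QFn` (`UHSSearch.lean`), polynomial time in the padded length, whose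
   value on this pad is `[L(x)]` (`UHSSearch.QFn_pad`, from the machine-independent core of
   `UniversalHeuristicSchemesProofs.lean`);

and its running time is `poly(2^{m(n)}, n) ≤ A · 2^{B · mtot(n)} + A ≤ c · 2^{c n / ⌊log₂ n⌋} + c`
(`UHSParam.exists_time_bound`, `UHSParameters.lean`). Main results: `exists_outputsWithin_uhs` (the
composite machine and its per-input time) and **`Hirahara2021_mem_DTIME_of_hasUHS_holds`**.

## References

* S. Hirahara, *Average-case hardness of NP from exponential worst-case hardness assumptions*,
  STOC 2021, 292–302; full version ECCC TR21-058: Lemma 2.3, Thm. 6.3 (proof), Cor. 6.4.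
* S. Arora, B. Barak, *Computational Complexity: A Modern Approach*, CUP 2009, §1.3 (composition
  of machines), §2.6.2 (padding).
-/

namespace Literature.Computability.MetaComplexity

open _root_.Computability Complexity Complexity.Brick Polynomial Turing

/-! ### The pad produced by the first two stages -/

/-- The first two stages produce exactly the pad of `UHSSearch.lean`:
`⟨expPad 1 (u(n)), x⟩ = pad (2^m) k E I x`. [folklore] -/
theorem boolPair_expPad_uFn (d a₀ : ℕ) (x : List Bool) :
    boolPair (expPad 1 (UHSPad.uFn d a₀ x)) x =
      UHSSearch.pad (2 ^ UHSParam.m d a₀ x.length) (UHSParam.k d a₀ x.length)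
        (UHSParam.E d x.length) (UHSParam.I d x.length) x := by
  rw [UHSSearch.pad, expPad, UHSPad.length_uFn, pow_one, UHSPad.uFn_apply]

/-! ### Polynomials against powers of two -/

/-- A polynomial evaluated below `a · Z` is `O(Z^D)`: `q(y) ≤ (a + 2)^{2^e} · Z^{2^e}` for `y ≤ a Z`,
`1 ≤ Z`, with the exponent `e` of `UHSParam.exists_pow_bound`. [folklore] -/
theorem eval_le_pow_of_le {q : Polynomial ℕ} {e : ℕ} (hq : ∀ m, q.eval m + 2 ≤ (m + 2) ^ (2 ^ e))
    {a Z y : ℕ} (hZ : 1 ≤ Z) (hy : y ≤ a * Z) : q.eval y ≤ (a + 2) ^ (2 ^ e) * Z ^ (2 ^ e) := by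
  have h1 : q.eval y + 2 ≤ (y + 2) ^ (2 ^ e) := hq y
  have h2 : y + 2 ≤ (a + 2) * Z := by nlinarith
  calc q.eval y ≤ (y + 2) ^ (2 ^ e) := by omega
    _ ≤ ((a + 2) * Z) ^ (2 ^ e) := Nat.pow_le_pow_left h2 _
    _ = (a + 2) ^ (2 ^ e) * Z ^ (2 ^ e) := mul_pow _ _ _

/-! ### The composite machine -/

/-- **The `2^{O(n / log n)}`-time machine.** Given the data of Thm. 6.3's algorithm — a solver `S`
and a checker `C`, polynomial-time on the scheme encoding, satisfying the two items of Def. 6.2 for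
a polynomial `p₁` with `p₁(m) ≥ max (m, c₀)` and `p₁(m) + 2 ≤ (m + 2)^{2^d}`, where `K^t(x) ≤ |x| + a₀`
for `t ≥ c₀` — there is a TM2 machine that on every input `x` outputs `[L(x)]` within
`A · 2^{B · mtot d a₀ |x|} + A` steps. (Stages: parameters, exponential pad on the first
component, search; times add per input.) [Hirahara 2021 (ECCC TR21-058), proof of Thm. 6.3 and
Cor. 6.4] [cite: Hirahara2021, Thm. 6.3 (proof)] -/
theorem exists_outputsWithin_uhs {U : UniversalMachine} {L : Language Bool}
    {S C : List Bool → ℕ → ℕ → Bool} {p₁ : Polynomial ℕ} {d a₀ c₀ : ℕ}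
    (hS : PolyTimeComputable schemeEnc encodeBool fun q : List Bool × ℕ × ℕ => S q.1 q.2.1 q.2.2)
    (hC : PolyTimeComputable schemeEnc encodeBool fun q : List Bool × ℕ × ℕ => C q.1 q.2.1 q.2.2)
    (h₁ : ∀ (x : List Bool) (t k : ℕ), p₁.eval x.length ≤ t →
      U.cdAt t (p₁.eval t) x ≤ k → C x t k = true)
    (h₂ : ∀ (x : List Bool) (t k : ℕ), p₁.eval x.length ≤ t →
      C x t k = true → S x t (2 ^ k) = L.boolIndicator x)
    (hp : ∀ m, m ≤ p₁.eval m)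
    (hK : ∀ (x : List Bool) (t : ℕ), c₀ ≤ t → U.ktAt t x ≤ x.length + a₀)
    (hc₀ : ∀ m, c₀ ≤ p₁.eval m) (hd : ∀ m, p₁.eval m + 2 ≤ (m + 2) ^ (2 ^ d)) :
    ∃ (M : TM2ComputableAux Bool Bool) (A B : ℕ), ∀ x : List Bool,
      M.OutputsWithin x [L.boolIndicator x] (A * 2 ^ (B * UHSParam.mtot d a₀ x.length) + A) := by
  -- the three machines
  obtain ⟨qF, MF, hMF⟩ := UHSPad.FFn_mem_FP d a₀
  obtain ⟨CE, ME, hME⟩ := exists_timeComputable_expPad (k := 1) le_rfl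
  obtain ⟨qQ, MQ, hMQ⟩ := UHSSearch.QFn_mem_FP S C p₁ hS hC
  obtain ⟨eF, -, heF⟩ := UHSParam.exists_pow_bound qF
  obtain ⟨eQ, -, heQ⟩ := UHSParam.exists_pow_bound qQ
  refine ⟨MF.comp ((mapFstAux ME).comp MQ),
    3 ^ (2 ^ eF) + 11 ^ (2 ^ eQ) + (2 * CE + 25), 2 ^ eF + 2 ^ eQ + 1, fun x => ?_⟩
  set n := x.length with hn
  set u := UHSPad.uFn d a₀ x with hu
  set P := boolPair (expPad 1 u) x with hP
  -- stage 1
  have h1 : MF.OutputsWithin x (boolPair u x) (qF.eval n) := by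
    have := hMF x; rwa [UHSPad.FFn_apply] at this
  -- stage 2
  have h2 : (mapFstAux ME).OutputsWithin (boolPair u x) P
      ((CE * 2 ^ (u.length ^ 1) + CE) + 3 * (expPad 1 u).length + 2 * (boolPair u x).length + 6) := by
    have h := outputsWithin_mapFstAux ME (z := boolPair u x) (out := expPad 1 u)
      (m := CE * 2 ^ (u.length ^ 1) + CE) (by simpa using hME u)
    rwa [readRest_boolPair] at h
  -- stage 3
  have h3 : MQ.OutputsWithin P [L.boolIndicator x] (qQ.eval P.length) := by
    have := hMQ P
    rwa [id, hP, boolPair_expPad_uFn, UHSSearch.QFn_pad S C p₁ h₁ h₂ hp hK hc₀ hd x,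
      ← boolPair_expPad_uFn, ← hu] at this
  have h := TM2ComputableAux.comp_outputsWithin MF _ h1 (TM2ComputableAux.comp_outputsWithin _ MQ h2 h3)
  refine h.mono ?_
  -- time bookkeeping: everything is `poly(Z)`, `Z = 2^{mtot}`
  set T := UHSParam.mtot d a₀ n with hT
  set Z := 2 ^ T with hZ
  have hZ1 : 1 ≤ Z := Nat.one_le_two_pow
  have hm : u.length = UHSParam.m d a₀ n := UHSPad.length_uFn d a₀ x
  have hmT : UHSParam.m d a₀ n ≤ T := UHSParam.m_le_mtot d a₀ n
  have h2m : 2 ^ u.length ≤ Z := by rw [hm]; exact Nat.pow_le_pow_right two_pos hmT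
  have hmZ : u.length ≤ Z := by rw [hm]; exact hmT.trans (Nat.lt_two_pow_self).le
  have hnZ : n ≤ Z := (UHSParam.lt_two_pow_mtot d a₀ n).le
  have hlenE : (expPad 1 u).length = 2 ^ u.length + u.length + 1 := by rw [length_expPad, pow_one]
  have hlenux : (boolPair u x).length = 2 * u.length + 2 + n := length_boolPair u x
  have hlenP : P.length ≤ 9 * Z := by
    rw [hP, length_boolPair, hlenE]; omega
  have hqF : qF.eval n ≤ 3 ^ (2 ^ eF) * Z ^ (2 ^ eF) :=
    eval_le_pow_of_le heF hZ1 (a := 1) (by omega)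
  have hqQ : qQ.eval P.length ≤ 11 ^ (2 ^ eQ) * Z ^ (2 ^ eQ) := eval_le_pow_of_le heQ hZ1 hlenP
  have hrest : CE * 2 ^ (u.length ^ 1) + CE + 3 * (expPad 1 u).length + 2 * (boolPair u x).length + 6 ≤
      (2 * CE + 25) * Z := by
    rw [pow_one, hlenE, hlenux]; nlinarith
  -- powers of `Z` against `Z^B`, `B = 2^eF + 2^eQ + 1`
  set B := 2 ^ eF + 2 ^ eQ + 1 with hB
  have hZB : ∀ i, i ≤ B → Z ^ i ≤ Z ^ B := fun i hi => Nat.pow_le_pow_right hZ1 hi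
  have hZF := hZB (2 ^ eF) ((Nat.le_add_right _ _).trans (Nat.le_add_right _ _))
  have hZQ := hZB (2 ^ eQ) ((Nat.le_add_left _ _).trans (Nat.le_add_right _ _))
  have hZ1B : Z ≤ Z ^ B := by simpa using hZB 1 (Nat.le_add_left 1 _)
  have hpow : Z ^ B = 2 ^ (B * T) := by rw [hZ, ← pow_mul, Nat.mul_comm]
  calc qQ.eval P.length + (CE * 2 ^ (u.length ^ 1) + CE + 3 * (expPad 1 u).length +
          2 * (boolPair u x).length + 6) + qF.eval n
      ≤ 11 ^ (2 ^ eQ) * Z ^ (2 ^ eQ) + (2 * CE + 25) * Z + 3 ^ (2 ^ eF) * Z ^ (2 ^ eF) := by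
        gcongr
    _ ≤ 11 ^ (2 ^ eQ) * Z ^ B + (2 * CE + 25) * Z ^ B + 3 ^ (2 ^ eF) * Z ^ B := by
        gcongr
    _ = (3 ^ (2 ^ eF) + 11 ^ (2 ^ eQ) + (2 * CE + 25)) * 2 ^ (B * T) := by rw [← hpow]; ring
    _ ≤ (3 ^ (2 ^ eF) + 11 ^ (2 ^ eQ) + (2 * CE + 25)) * 2 ^ (B * T) +
          (3 ^ (2 ^ eF) + 11 ^ (2 ^ eQ) + (2 * CE + 25)) := Nat.le_add_right _ _

/-! ### The discharge -/

/-- **Discharge of `Hirahara2021_mem_DTIME_of_hasUHS` (Hirahara 2021, Lemma 2.3 = Cor. 6.4).**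
For every efficient universal machine `U` and every language `L`: if `L` admits a universal
heuristic scheme, then `L ∈ ⋃ c, DTIME(2^{c n / ⌊log₂ n⌋})`. Proof as printed (Thm. 6.3 with
`s(n) = n + O(1)`): enlarge the scheme polynomial (`exists_items_ge`) so that `p₁(m) ≥ max (m, c₀)`
for the constant `c₀` of the trivial bound `K^t(x) ≤ |x| + a₀` (`exists_ktAt_le_length_add`), bound
it by a power (`UHSParam.exists_pow_bound`), run the composite machine (`exists_outputsWithin_uhs`),
and convert its time bound `A · 2^{B · mtot(n)} + A` into `c · 2^{c n / ⌊log₂ n⌋} + c`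
(`UHSParam.exists_time_bound`). [Hirahara 2021 (ECCC TR21-058), Lemma 2.3, Thm. 6.3, Cor. 6.4]
[cite: Hirahara2021, Cor. 6.4] -/
theorem Hirahara2021_mem_DTIME_of_hasUHS_holds : Hirahara2021_mem_DTIME_of_hasUHS := by
  intro U L hL
  obtain ⟨S, C, hSC⟩ := hL
  obtain ⟨c₀, a₀, hK⟩ := U.exists_ktAt_le_length_add
  obtain ⟨p₁, hq, hitems⟩ := hSC.exists_items_ge (X + Polynomial.C c₀)
  have hp : ∀ m, m ≤ p₁.eval m := fun m => le_trans (by simp) (hq m)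
  have hc₀ : ∀ m, c₀ ≤ p₁.eval m := fun m => le_trans (by simp) (hq m)
  obtain ⟨d, hd1, hd⟩ := UHSParam.exists_pow_bound p₁
  obtain ⟨M, A, B, hM⟩ := exists_outputsWithin_uhs (U := U) (L := L) hSC.solver_polyTime
    hSC.checker_polyTime (fun x t k ht => (hitems x t k ht).1) (fun x t k ht => (hitems x t k ht).2)
    hp hK hc₀ hd
  obtain ⟨c, hc⟩ := UHSParam.exists_time_bound d a₀ hd1 A B
  refine Set.mem_iUnion.2 ⟨c, c, M, fun x => ?_⟩
  exact (hM x).mono (hc x.length)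

end Literature.Computability.MetaComplexity
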